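import Literature.Geometry.Riemannian.EinsteinWeylZero
import Literature.Geometry.Lorentzian.CoordCurvatureContinuity
import Literature.Geometry.Riemannian.CurvatureNormSq
import Literature.Geometry.Riemannian.RicciFlowChartMetricBounds
import Literature.Geometry.Riemannian.RicciFlowScaling
import Literature.Geometry.Riemannian.MetricTraceScaling
import Summits.SmoothPoincare4.SmoothPoincare4.Theorems.EntropyRungChangGurskyYangStubLimitRound
import HarnessLib

/-!
# The smooth chart-limit of the scaled metrics is round, I: curvature under `C²` convergence of
# metric components, and the limits of the scaled roundness quantities
(helper file for stub `helper_scaledLimit_round`, layer S5b of `stub_smoothRoundLimit`, line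
`margerin-cone-hamilton-rails`, crux `EntropyRung.ChangGurskyYang`, item stmt-SmoothPoincare4-10834)

Along a Ricci flow `g(t)` of Riemannian metrics on `[0, T)` on a closed `4`-manifold with the
roundness rates `|(T−t)R − 2| ≤ C(T−t)^δ`, `(T−t)²(|Ric|² − R²/4) ≤ C(T−t)^{2δ}`,
`(T−t)²(|Rm|² − 2|Ric|² + R²/3) ≤ C(T−t)^δ` (Hamilton 1982, §17, Thm. 17.6 ff.), the scaled
metrics `g(t)/(T−t)` converge in `C^∞` in charts to a limit metric `g'`, which is then Einstein
with `W = 0` (Hamilton 1982, §17, Cor. 17.11) because curvature passes to `C²` limits of the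
metric components (Petersen 2006, Ch. 10, §3.2). This file supplies the tools of that passage:

* `tendsto_riemAt`, `tendsto_ginv`, `tendsto_rmNormSqAt` — in the `MetricCoord` framework, the
  curvature endomorphisms, the inverse metric and `|Rm|²` of metric components are continuous in
  the 2-jet `(G(x), DG(x), D²G(x))` (companions of `tendsto_ricAt_apply` of
  `CoordCurvatureContinuity.lean`);
* `jets_of_tendsto_iteratedFDeriv` — convergence of all `iteratedFDeriv`s at a point gives the
  convergence of values, first and second derivatives (the currying isometries);
* `exists_seq_tendsto`, `tendsto_scaled_curvNormSq` / `helper_scaledCurvNormSq_tendsto` — a time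
  sequence `sₙ ↑ T` and the elementary limit `h²|Rm|² = h²|W|² + 2h²|E|² + (hR)²/6 → 2/3` forced by
  the rates (`h = T − t → 0`);
* the chart dictionary at a point: `ricAt_chartRep_const_eq` (`Ric` of a single metric read in a
  chart, for any Levi-Civita witness), `chartRep_constSmul` (the representative of `c g`),
  `curvNormSqWith_constSmul_eq` (`|Rm|²_{cg} = c⁻²|Rm|²_g`) and
  `normSq_ricci_eq_one_of_ricci_eq_half` (`|Ric|² = 1` when `Ric = g/2`).

## References

* R. S. Hamilton, *Three-manifolds with positive Ricci curvature*, J. Differential Geom. 17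
  (1982) 255–306, §17, Thm. 17.6, Cor. 17.11. [Hamilton1982]
* A. L. Besse, *Einstein Manifolds* (1987), 1.114–1.118. [Besse1987]
* P. Petersen, *Riemannian Geometry*, 2nd ed., GTM 171, Springer 2006, Ch. 10, §3.2 (curvature
  under `C²` convergence of metrics). [Petersen2006]
* B. O'Neill, *Semi-Riemannian geometry*, Academic Press 1983, Ch. 3, Lemma 3.38. [ONeill1983]
-/

noncomputable section

-- every `Summit.SmoothPoincare4.SmoothPoincare4.…` name repeats the summit = sub-problem segment (D-0017 layout)
set_option linter.dupNamespace false

-- operator spaces of bilinear forms over the model space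
set_option maxSynthPendingDepth 3

open Set Function Filter Module Metric
open scoped Manifold ContDiff Topology

namespace Summit.SmoothPoincare4.SmoothPoincare4.Theorems.MargerinRails

open Literature.Geometry.Riemannian
open Literature.Geometry.Lorentzian Literature.Geometry.Lorentzian.PseudoRiemannianMetric
open Literature.Geometry.Lorentzian.MetricCoord

/-! ### Continuity of `R` and `|Rm|²` of metric components in the 2-jet -/

section CoordContinuity

variable {ι : Type*} {l : Filter ι} {E : Type*} [NormedAddCommGroup E] [NormedSpace ℝ E]
  [CompleteSpace E] {Gs : ι → E → E →L[ℝ] E →L[ℝ] ℝ} {G : E → E →L[ℝ] E →L[ℝ] ℝ} {V : Set E}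
  {x : E}

/-- **The curvature endomorphism `R(X,Y) ∈ End E` is continuous in the 2-jet** (operator-norm
version of `tendsto_riemAt_apply`: `R = DΓ − DΓ + Γ∘Γ − Γ∘Γ`). [cite: ONeill1983, Ch. 3, Lemma 3.38] -/
theorem tendsto_riemAt (hGs : ∀ i, IsMetricOn (Gs i) V) (hG : IsMetricOn G V) (hx : x ∈ V)
    (h0 : Tendsto (fun i ↦ Gs i x) l (𝓝 (G x)))
    (h1 : Tendsto (fun i ↦ fderiv ℝ (Gs i) x) l (𝓝 (fderiv ℝ G x)))
    (h2 : Tendsto (fun i ↦ fderiv ℝ (fderiv ℝ (Gs i)) x) l (𝓝 (fderiv ℝ (fderiv ℝ G) x)))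
    (X Y : E) :
    Tendsto (fun i ↦ riemAt (Gs i) x X Y) l (𝓝 (riemAt G x X Y)) := by
  have hDXY := tendsto_fderiv_chrAt_apply₂ hGs hG hx h0 h1 h2 X Y
  have hDYX := tendsto_fderiv_chrAt_apply₂ hGs hG hx h0 h1 h2 Y X
  have hΓX := tendsto_chrAt_apply hG hx h0 h1 X
  have hΓY := tendsto_chrAt_apply hG hx h0 h1 Y
  have h := ((hDXY.sub hDYX).add (tendsto_clm_comp hΓX hΓY)).sub (tendsto_clm_comp hΓY hΓX)
  exact h

variable [FiniteDimensional ℝ E]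

/-- **The inverse metric coefficients `g^{ij}` are continuous in the 0-jet**. [folklore] -/
theorem tendsto_ginv {κ : Type*} [Fintype κ] (b : Basis κ ℝ E) (hG : IsMetricOn G V)
    (hx : x ∈ V) (h0 : Tendsto (fun i ↦ Gs i x) l (𝓝 (G x))) (a a' : κ) :
    Tendsto (fun i ↦ ginv (Gs i) b x a a') l (𝓝 (ginv G b x a a')) := by
  unfold ginv
  exact ((b.coord a).continuous_of_finiteDimensional.tendsto _).comp
    (tendsto_clm_apply_const (tendsto_sharpAt hG hx h0) (coordCLM b a'))

/-- **`|Rm|²` of metric components is continuous in the 2-jet**: if the jets of `Gᵢ` converge to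
the jet of `G` at `x`, then `|Rm[Gᵢ]|²(x) → |Rm[G]|²(x)` (the basis formula `rmNormSqAt_eq_sum`, a
polynomial in `g^{ij}` and the curvature endomorphisms). [cite: Petersen2006, Ch. 10, §3.2] -/
theorem tendsto_rmNormSqAt (hGs : ∀ i, IsMetricOn (Gs i) V) (hG : IsMetricOn G V) (hx : x ∈ V)
    (h0 : Tendsto (fun i ↦ Gs i x) l (𝓝 (G x)))
    (h1 : Tendsto (fun i ↦ fderiv ℝ (Gs i) x) l (𝓝 (fderiv ℝ G x)))
    (h2 : Tendsto (fun i ↦ fderiv ℝ (fderiv ℝ (Gs i)) x) l (𝓝 (fderiv ℝ (fderiv ℝ G) x))) :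
    Tendsto (fun i ↦ rmNormSqAt (Gs i) x) l (𝓝 (rmNormSqAt G x)) := by
  let b := Module.finBasis ℝ E
  simp only [rmNormSqAt_eq_sum b]
  refine Tendsto.neg (tendsto_finsetSum _ fun a _ ↦ tendsto_finsetSum _ fun a' _ ↦
    tendsto_finsetSum _ fun c _ ↦ tendsto_finsetSum _ fun c' _ ↦ ?_)
  exact ((tendsto_ginv b hG hx h0 a a').mul (tendsto_ginv b hG hx h0 c c')).mul
    (((traceCLM E).continuous.tendsto _).comp
      (tendsto_clm_comp (tendsto_riemAt hGs hG hx h0 h1 h2 (b a) (b c))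
        (tendsto_riemAt hGs hG hx h0 h1 h2 (b a') (b c'))))

end CoordContinuity

/-! ### Jets from the convergence of the iterated derivatives -/

section Jets

variable {ι : Type*} {l : Filter ι} {P : Type*} [NormedAddCommGroup P] [NormedSpace ℝ P]
  {G : Type*} [NormedAddCommGroup G] [NormedSpace ℝ G] {F : ι → P → G} {F' : P → G} {x : P}

/-- If all iterated derivatives of `Fᵢ` converge to those of `F'` at `x`, the same holds for the
families of first derivatives (`D^m(Df) = curry (D^{m+1} f)`). [folklore] -/
theorem tendsto_iteratedFDeriv_fderiv
    (h : ∀ m : ℕ, Tendsto (fun i ↦ iteratedFDeriv ℝ m (F i) x) l (𝓝 (iteratedFDeriv ℝ m F' x)))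
    (m : ℕ) :
    Tendsto (fun i ↦ iteratedFDeriv ℝ m (fderiv ℝ (F i)) x) l
      (𝓝 (iteratedFDeriv ℝ m (fderiv ℝ F') x)) := by
  have key : ∀ f : P → G, iteratedFDeriv ℝ m (fderiv ℝ f) x =
      continuousMultilinearCurryRightEquiv' ℝ m P G (iteratedFDeriv ℝ (m + 1) f x) := by
    intro f
    rw [iteratedFDeriv_succ_eq_comp_right, Function.comp_apply, LinearIsometryEquiv.apply_symm_apply]
  simp only [key]
  exact ((continuousMultilinearCurryRightEquiv' ℝ m P G).continuous.tendsto _).comp (h (m + 1))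

/-- Convergence of the `0`-th iterated derivatives is convergence of the values. [folklore] -/
theorem tendsto_of_iteratedFDeriv_zero
    (h : Tendsto (fun i ↦ iteratedFDeriv ℝ 0 (F i) x) l (𝓝 (iteratedFDeriv ℝ 0 F' x))) :
    Tendsto (fun i ↦ F i x) l (𝓝 (F' x)) := by
  have := ((continuous_eval_const (0 : Fin 0 → P)).tendsto _).comp h
  exact this

/-- **The 2-jets converge** when all iterated derivatives converge at the point: values, first and
second derivatives. [folklore] -/
theorem jets_of_tendsto_iteratedFDeriv
    (h : ∀ m : ℕ, Tendsto (fun i ↦ iteratedFDeriv ℝ m (F i) x) l (𝓝 (iteratedFDeriv ℝ m F' x))) :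
    Tendsto (fun i ↦ F i x) l (𝓝 (F' x)) ∧
    Tendsto (fun i ↦ fderiv ℝ (F i) x) l (𝓝 (fderiv ℝ F' x)) ∧
    Tendsto (fun i ↦ fderiv ℝ (fderiv ℝ (F i)) x) l (𝓝 (fderiv ℝ (fderiv ℝ F') x)) := by
  have h1 := tendsto_iteratedFDeriv_fderiv h
  have h2 := tendsto_iteratedFDeriv_fderiv (F := fun i ↦ fderiv ℝ (F i)) h1
  exact ⟨tendsto_of_iteratedFDeriv_zero (h 0), tendsto_of_iteratedFDeriv_zero (h1 0),
    tendsto_of_iteratedFDeriv_zero (h2 0)⟩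

end Jets

/-! ### The time sequence and the limits of the scaled roundness quantities -/

section Rates

/-- **A sequence of times `sₙ ↑ T` in `[0, T)`** (`sₙ = T − T/(n+2)`), along which the limits
`t ↑ T` are read. [folklore] -/
theorem exists_seq_tendsto {T : ℝ} (hT : 0 < T) :
    ∃ s : ℕ → ℝ, (∀ n, s n ∈ Ico 0 T) ∧ Tendsto s atTop (𝓝 T) := by
  refine ⟨fun n ↦ T - T / (n + 2), fun n ↦ ?_, ?_⟩
  · have hn : (0 : ℝ) < n + 2 := by positivity
    refine ⟨?_, ?_⟩
    · rw [sub_nonneg, div_le_iff₀ hn]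
      nlinarith
    · rw [sub_lt_self_iff]
      exact div_pos hT hn
  · have h : Tendsto (fun n : ℕ ↦ T / ((n : ℝ) + 2)) atTop (𝓝 0) :=
      tendsto_const_nhds.div_atTop (tendsto_natCast_atTop_atTop.atTop_add tendsto_const_nhds)
    have := tendsto_const_nhds (x := T).sub h
    rw [sub_zero] at this
    exact this

/-- Along `sₙ → T`: `T − sₙ → 0`. [folklore] -/
theorem tendsto_const_sub_of_tendsto {s : ℕ → ℝ} {T : ℝ} (hs : Tendsto s atTop (𝓝 T)) :
    Tendsto (fun n ↦ T - s n) atTop (𝓝 0) := by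
  have := tendsto_const_nhds (x := T).sub hs
  rw [sub_self] at this
  exact this

/-- Along `sₙ → T`: eventually `t₂ ≤ sₙ`, for every `t₂ < T`. [folklore] -/
theorem eventually_le_of_tendsto {s : ℕ → ℝ} {T t₂ : ℝ} (hs : Tendsto s atTop (𝓝 T))
    (ht₂ : t₂ < T) : ∀ᶠ n in atTop, t₂ ≤ s n :=
  ((tendsto_order.1 hs).1 t₂ ht₂).mono fun _ hn ↦ hn.le

/-- **The roundness rates force `h²|Rm|² → 2/3`**: if `hₙ → 0⁺`, `|hₙRₙ − 2| ≤ C hₙ^δ`,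
`0 ≤ hₙ²(Nₙ − Rₙ²/4) ≤ C hₙ^{2δ}` and `0 ≤ hₙ²(Qₙ − 2Nₙ + Rₙ²/3) ≤ C hₙ^δ` eventually (`δ > 0`),
then `hₙ² Qₙ → 2/3` (`h²Q = h²|W|² + 2h²|E|² + (hR)²/6`). [cite: Hamilton1982, §17, Cor. 17.11] -/
theorem tendsto_scaled_curvNormSq {h R N Q : ℕ → ℝ} {C δ : ℝ} (hδ : 0 < δ)
    (hh : Tendsto h atTop (𝓝 0))
    (h1 : ∀ᶠ n in atTop, |h n * R n - 2| ≤ C * h n ^ δ)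
    (h2 : ∀ᶠ n in atTop, h n ^ 2 * (N n - R n ^ 2 / 4) ≤ C * h n ^ (2 * δ))
    (h3 : ∀ᶠ n in atTop, h n ^ 2 * (Q n - 2 * N n + R n ^ 2 / 3) ≤ C * h n ^ δ)
    (hE : ∀ᶠ n in atTop, 0 ≤ N n - R n ^ 2 / 4)
    (hW : ∀ᶠ n in atTop, 0 ≤ Q n - 2 * N n + R n ^ 2 / 3) :
    Tendsto (fun n ↦ h n ^ 2 * Q n) atTop (𝓝 (2 / 3)) := by
  -- the rates tend to zero
  have hCδ : Tendsto (fun n ↦ C * h n ^ δ) atTop (𝓝 0) := by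
    have := (hh.rpow_const (Or.inr hδ.le)).const_mul C
    rwa [Real.zero_rpow hδ.ne', mul_zero] at this
  have hC2δ : Tendsto (fun n ↦ C * h n ^ (2 * δ)) atTop (𝓝 0) := by
    have h2δ : 0 < 2 * δ := by positivity
    have := (hh.rpow_const (Or.inr h2δ.le)).const_mul C
    rwa [Real.zero_rpow h2δ.ne', mul_zero] at this
  -- `hR → 2`
  have hR : Tendsto (fun n ↦ h n * R n) atTop (𝓝 2) := by
    have h0 : Tendsto (fun n ↦ h n * R n - 2) atTop (𝓝 0) :=
      squeeze_zero_norm' (h1.mono fun n hn ↦ by simpa [Real.norm_eq_abs] using hn) hCδ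
    have := h0.add_const 2
    simpa using this
  -- `h²|E|² → 0`, `h²|W|² → 0`
  have hEt : Tendsto (fun n ↦ h n ^ 2 * (N n - R n ^ 2 / 4)) atTop (𝓝 0) :=
    tendsto_of_tendsto_of_tendsto_of_le_of_le' tendsto_const_nhds hC2δ
      (hE.mono fun n hn ↦ mul_nonneg (sq_nonneg _) hn) h2
  have hWt : Tendsto (fun n ↦ h n ^ 2 * (Q n - 2 * N n + R n ^ 2 / 3)) atTop (𝓝 0) :=
    tendsto_of_tendsto_of_tendsto_of_le_of_le' tendsto_const_nhds hCδ
      (hW.mono fun n hn ↦ mul_nonneg (sq_nonneg _) hn) h3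
  have key := (hWt.add (hEt.const_mul 2)).add ((hR.pow 2).div_const 6)
  have heq : ∀ n, h n ^ 2 * (Q n - 2 * N n + R n ^ 2 / 3) + 2 * (h n ^ 2 * (N n - R n ^ 2 / 4)) +
      (h n * R n) ^ 2 / 6 = h n ^ 2 * Q n := fun n ↦ by ring
  simp only [heq] at key
  norm_num at key
  exact key

end Rates

/-! ### The chart dictionary at a point, for a single metric and for the scaled metric -/

section Dictionary

variable {M : Type*} [TopologicalSpace M] [ChartedSpace (EuclideanSpace ℝ (Fin 4)) M]
  [IsManifold (𝓡 4) ∞ M]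

/-- **The coordinate Ricci form of a metric read in a chart is its Ricci tensor on the frame
vectors**: `Ric(chartRep g₁)(y)(v, w) = Ric_{cov₁}(Φ y)(dΦ v, dΦ w)` for any Levi-Civita witness
`cov₁` of `g₁` (naturality of `Ric` under the inverse chart `Φ`, `ricci_comap_apply`, and
`OpensChart.ricci_eq_ricAt`). [cite: Petersen2006, Ch. 10, §3.2] -/
theorem ricAt_chartRep_const_eq
    (g₁ : PseudoRiemannianMetric (𝓡 4) ∞ (EuclideanSpace ℝ (Fin 4)) (TangentSpace (𝓡 4) : M → Type _))
    {cov₁ : CovariantDerivative (𝓡 4) (EuclideanSpace ℝ (Fin 4)) (TangentSpace (𝓡 4) : M → Type _)}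
    (hLC : g₁.IsLeviCivita cov₁) (z : M) (y : chartTarget (𝓡 4) z) (v w : EuclideanSpace ℝ (Fin 4)) :
    ricAt (chartRep (𝓡 4) (fun _ ↦ g₁) z 0) y v w =
      cov₁.ricci (chartInv (𝓡 4) z y)
        (mfderiv 𝓘(ℝ, EuclideanSpace ℝ (Fin 4)) (𝓡 4) (chartInv (𝓡 4) z) y v)
        (mfderiv 𝓘(ℝ, EuclideanSpace ℝ (Fin 4)) (𝓡 4) (chartInv (𝓡 4) z) y w) := by
  haveI := g₁.hasLeviCivita
  haveI := (chartPullback (𝓡 4) g₁ z).hasLeviCivita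
  have h2 : (2 : ℕ∞ω) ≤ ∞ := WithTop.coe_le_coe.mpr le_top
  rw [hLC.ricci_eq_ricci h2,
    ← OpensChart.ricci_eq_ricAt (val_chartPullback_eq_chartRep (fun _ ↦ g₁) z 0) y v w,
    g₁.ricci_comap_apply contMDiff_pullbackBilin_holds (contMDiff_chartInv z)
      (injective_mfderiv_chartInv z) rfl y v w]

variable {g : ℝ → PseudoRiemannianMetric (𝓡 4) ∞ (EuclideanSpace ℝ (Fin 4)) (TangentSpace (𝓡 4) : M → Type _)}
  {cov : ℝ → CovariantDerivative (𝓡 4) (EuclideanSpace ℝ (Fin 4)) (TangentSpace (𝓡 4) : M → Type _)}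
  {T : ℝ}

/-- **The chart representative of the scaled metric `c g(t)` is `c` times that of `g(t)`**
(`chartRep` is linear in the coefficients). [folklore] -/
theorem chartRep_constSmul (z : M) (t c : ℝ) (hc : c ≠ 0) :
    chartRep (𝓡 4) (fun _ ↦ (g t).constSmul c hc) z 0 =
      fun y ↦ c • chartRep (𝓡 4) g z t y := by
  funext y
  ext v w
  simp only [chartRep, gramOpFamily, ContinuousLinearMap.bilinearComp_apply, _root_.smul_apply,
    smul_eq_mul]
  exact constSmul_apply _ _ _ _ _ _

/-- `|Rm|²` under homothety: `|Rm|²_{c g} = c⁻² |Rm|²_g` (same connection; the traces scale by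
`c⁻¹` each, `trace_constSmul`). [cite: Hamilton1982, §17, Cor. 17.11] -/
theorem curvNormSqWith_constSmul_eq
    (g₁ : PseudoRiemannianMetric (𝓡 4) ∞ (EuclideanSpace ℝ (Fin 4)) (TangentSpace (𝓡 4) : M → Type _))
    (cov₁ : CovariantDerivative (𝓡 4) (EuclideanSpace ℝ (Fin 4)) (TangentSpace (𝓡 4) : M → Type _))
    (c : ℝ) (hc : c ≠ 0) (x : M) :
    (g₁.constSmul c hc).curvNormSqWith cov₁ x = c⁻¹ ^ 2 * g₁.curvNormSqWith cov₁ x := by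
  have hinner : (g₁.constSmul c hc).curvInnerForm cov₁ x = c⁻¹ • g₁.curvInnerForm cov₁ x := by
    ext X X'
    rw [curvInnerForm_apply, LinearMap.smul_apply, LinearMap.smul_apply, curvInnerForm_apply,
      trace_constSmul, smul_eq_mul]
  rw [curvNormSqWith, curvNormSqWith, hinner, trace_smul', trace_constSmul]
  ring

/-- **`|Ric|² = 1` for `Ric = g/2` in dimension four** (`Σ_{ab} (δ_{ab}/2)² = 1` in an
orthonormal basis, `ricciNormSqFrame_eq_normSq`). [cite: Besse1987, 1.118] -/
theorem normSq_ricci_eq_one_of_ricci_eq_half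
    (g' : PseudoRiemannianMetric (𝓡 4) ∞ (EuclideanSpace ℝ (Fin 4)) (TangentSpace (𝓡 4) : M → Type _))
    [g'.HasLeviCivita] (hg' : g'.IsRiemannian)
    (hRic : ∀ (x : M) (X Y : TangentSpace (𝓡 4) x), g'.ricci x X Y = 1 / 2 * g'.val x X Y)
    (x : M) : g'.normSq x (g'.ricci x) = 1 := by
  classical
  obtain ⟨b, hb⟩ := g'.exists_basis_isOrthonormalFrame (hg' x) finrank_euclideanFour
  rw [← g'.ricciNormSqFrame_eq_normSq hb (by rw [Fintype.card_fin, finrank_euclideanFour]),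
    ricciNormSqFrame]
  have hδ : ∀ a c : Fin 4, g'.val x (b a) (b c) = if a = c then 1 else 0 := by
    intro a c
    by_cases hac : a = c
    · subst hac; simp [hb.1 a]
    · simp [hac, hb.2 a c hac]
  simp only [hRic, hδ]
  simp
  norm_num

end Dictionary

/-! ### The registered helper of this file -/

/-- **HELPER `helper_scaledCurvNormSq_tendsto` — the roundness rates force `(T−t)²|Rm|² → 2/3`**
(the elementary limit behind Hamilton 1982, §17, Cor. 17.11, registered form of
`tendsto_scaled_curvNormSq`): if `hₙ → 0`, `|hₙRₙ − 2| ≤ C hₙ^δ`,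
`0 ≤ hₙ²(Nₙ − Rₙ²/4) ≤ C hₙ^{2δ}` and `0 ≤ hₙ²(Qₙ − 2Nₙ + Rₙ²/3) ≤ C hₙ^δ` eventually
(`δ > 0`), then `hₙ²Qₙ → 2/3`. [cite: Hamilton1982, §17, Cor. 17.11] -/
theorem helper_scaledCurvNormSq_tendsto : ∀ (h R N Q : ℕ → ℝ) (C δ : ℝ), 0 < δ → Tendsto h atTop (𝓝 0) → (∀ᶠ n in atTop, |h n * R n - 2| ≤ C * h n ^ δ) → (∀ᶠ n in atTop, h n ^ 2 * (N n - R n ^ 2 / 4) ≤ C * h n ^ (2 * δ)) → (∀ᶠ n in atTop, h n ^ 2 * (Q n - 2 * N n + R n ^ 2 / 3) ≤ C * h n ^ δ) → (∀ᶠ n in atTop, 0 ≤ N n - R n ^ 2 / 4) → (∀ᶠ n in atTop, 0 ≤ Q n - 2 * N n + R n ^ 2 / 3) → Tendsto (fun n ↦ h n ^ 2 * Q n) atTop (𝓝 (2 / 3)) := by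
  intro h R N Q C δ hδ hh h1 h2 h3 hE hW
  exact tendsto_scaled_curvNormSq hδ hh h1 h2 h3 hE hW

end Summit.SmoothPoincare4.SmoothPoincare4.Theorems.MargerinRails

end
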